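import Literature.Combinatorics.Sahi2008.Percolation
import Literature.Combinatorics.Sahi2008.ProvedCases
import Literature.Combinatorics.Sahi2008.Symmetry
import Mathlib.Combinatorics.SetFamily.LYM
import Mathlib.Data.Fintype.Perm
import HarnessLib

/-!
# Principal cluster events: the ANTICHAIN REDUCTION of all-orders Sahi positivity, and
# "the increasing star at `{a,b,c}` ⟺ every principal family with targets in `{a,b,c}`, at every order"

Support file for the Sahi programme (`--supports stmt-CriticalPhenomena-4575`, prover prim-sahi-p2 gen 10).
No definitions, no named facts, no sorries, no `native_decide`; standard axioms.  Memo `…/prim-sahi-p2/PROOF-E3.md` §21.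
(The `≤ 5`-vertex / `K₄` corollaries, which use the kernel-computational `FrontierIncRows.incStar_le_five`, are in the
companion file `…SahiPrincipalAntichainLeFive`.)

**Setting.**  `ι` finite, `p : ι → [0,1]`, the product weight `bernoulliWeight p` on `2^ι`; an `∩`-CLOSED family of
increasing events indexed by finite sets, `A : Finset β → Set (Set ι)` with `A (T ∪ T') = A T ∩ A T'` — the model case being
the PRINCIPAL CLUSTER EVENTS of bond percolation, `A T = {C_s ⊇ T} = ⋂_{t ∈ T} {s ↔ t}` (`ι = Sym2 V`).

**Theorem 1 (`sahiE_ind_nonneg_of_antichains`).**  If `E_k(1_{A T_1}, …, 1_{A T_k}) ≥ 0` for every ANTICHAIN family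
(`T_i ⊄ T_j` for `i ≠ j`; in particular no repeats) of size `k ≥ 3`, then `E_n(1_{A T_1}, …, 1_{A T_n}) ≥ 0` for EVERY `n` and
EVERY family (repeats allowed).  With `β` finite, Sperner's theorem bounds the antichain sizes by `C(|β|, ⌊|β|/2⌋)`
(`sahiE_ind_nonneg_of_antichains_sperner`): for a fixed finite graph, all-orders positivity of all principal cluster families
is a FINITE list of polynomial inequalities.  Mechanism: a family with a nested pair `T_i ⊆ T_j` has the slot `1_{A T_j}`
absorbed by the head `1_{A T_i}` in the Lieb–Sahi recursion (the tree's peel step `sahiE_cons_nonneg_of_absorbed`,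
[LiebSahi2021, Prop. 3.3]; the same mechanism as prim-sahi-p1's `SahiCubeAllOrders.sahiE_setInd_nonneg_of_nested` for the
lattice of ALL up-sets and prim-masterthm's `SahiDeltaSystem.sahiPositive_of_antichainBasis₂`) — here run INSIDE an
`∩`-closed subfamily, whose width is what matters; order `2` is Harris (`isFKGMeasure_bernoulliWeight`).

**Theorem 2 (`sahiE_principal_threeTargets_iff`).**  For a weighted graph, a root `s` and three vertices `v₀, v₁, v₂`:
EVERY family of principal cluster events `{C_s ⊇ T_i}` with all `T_i ⊆ {v₀, v₁, v₂}` is Sahi-positive at EVERY order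
`⟺` the increasing star `E₃({s↔v₀}, {s↔v₁}, {s↔v₂}) ≥ 0`.  (The antichains of `2^{3} ∖ {∅}` of size `≥ 3` are the three
singletons — the star — and the three pairs, a Δ-system whose `E₃ = (x−d)yz + d((1−y)(1−z) + (1−x)) ≥ 0` identically.)

**Corollaries** (companion file `…SahiPrincipalAntichainLeFive`): on every weighted graph with `≤ 5` vertices, every principal
family with targets among any three vertices is Sahi-positive at every order; on every weighted graph with FOUR vertices
(e.g. `K₄`, the first graph that is not series–parallel, and `K₄ − e`, the first θ-graph) EVERY principal cluster family is
Sahi-positive at EVERY order — the first all-orders statement of the programme beyond cactus graphs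
(`…SahiPrincipalCutVertex`, `…SahiPrincipalCycleBlocks`).
-/

noncomputable section

namespace Summit.CriticalPhenomena.PercolationContinuityZ3.Theorems

namespace SahiPrincipalAntichain

open Finset MeasureTheory Literature.Combinatorics.Sahi2008 Literature.Probability.Percolation
  Literature.Probability.LatticeModels
open Literature.Probability.Percolation.DecisionTree (ind ind_of_mem ind_of_not_mem ind_nonneg)
open scoped Classical

/-! ### Part 1.  The antichain reduction for `∩`-closed families of increasing events -/

section General

variable {ι β : Type*} [Fintype ι] [DecidableEq β]

omit [Fintype ι] [DecidableEq β] in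
/-- `1_A · 1_B = 1_{A ∩ B}` (plumbing). [folklore] -/
private theorem ind_mul_ind (A B : Set (Set ι)) : ind A * ind B = ind (A ∩ B) := by
  funext ω
  exact (BHK2006.ind_inter A B ω).symm

/-- **Antichain reduction.**  For an `∩`-closed family `A : Finset β → Set (Set ι)` of increasing events
(`A (T ∪ T') = A T ∩ A T'`) under the product weight: if every ANTICHAIN family (`T_i ⊄ T_j` for `i ≠ j`) of size
`k ≥ 3` has `E_k(1_{A T_1},…,1_{A T_k}) ≥ 0`, then EVERY family of every size has `E_n ≥ 0` (repeats allowed).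
Orders `≤ 1` are trivial, order `2` is Harris, and a nested pair `T_i ⊆ T_j` is peeled by the Lieb–Sahi recursion
with the slot `1_{A T_j}` absorbed by the head `1_{A T_i}`. [this work; mechanism: LiebSahi2021 Prop. 3.3] -/
theorem sahiE_ind_nonneg_of_antichains (p : ι → unitInterval) (A : Finset β → Set (Set ι))
    (hA : ∀ T T' : Finset β, A (T ∪ T') = A T ∩ A T') (hup : ∀ T, IsUpperSet (A T))
    (H : ∀ (k : ℕ) (T : Fin (k + 3) → Finset β), (Pairwise fun i j => ¬ T i ⊆ T j) →
      0 ≤ sahiE (bernoulliWeight p) (k + 3) (fun i => ind (A (T i)))) :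
    ∀ (n : ℕ) (T : Fin n → Finset β), 0 ≤ sahiE (bernoulliWeight p) n (fun i => ind (A (T i))) := by
  have hμ := isFKGMeasure_bernoulliWeight p
  have habsorb : ∀ {T T' : Finset β}, T ⊆ T' → ind (A T') * ind (A T) = ind (A T') := by
    intro T T' h
    rw [ind_mul_ind, ← hA, Finset.union_eq_left.2 h]
  intro n
  induction n with
  | zero => intro T; rw [sahiE_zero]
  | succ n ih =>
    intro T
    match n, ih with
    | 0, _ =>
      rw [sahiE_one_apply]
      exact ex_nonneg hμ.nonneg fun ω => ind_nonneg _ _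
    | 1, _ =>
      exact sahiPositive_two hμ _ (fun i ω => ind_nonneg _ _) (fun i => monotone_ind_of_isUpperSet (hup _))
    | m + 2, ih =>
      by_cases hanti : Pairwise fun i j => ¬ T i ⊆ T j
      · exact H m T hanti
      · unfold Pairwise at hanti
        push Not at hanti
        obtain ⟨i, j, hij, hsub⟩ := hanti
        -- head := slot `i` (the larger event), absorbed slot := `j` (since `T i ⊆ T j` gives `A (T j) ⊆ A (T i)`)
        obtain ⟨σ, hσ⟩ : ∃ σ : Equiv.Perm (Fin (m + 3)), σ = Equiv.swap 0 i := ⟨_, rfl⟩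
        have hσ0 : σ 0 = i := by rw [hσ, Equiv.swap_apply_left]
        have hfam : (fun k => ind (A (T (σ k)))) =
            Matrix.vecCons (ind (A (T i))) (fun k : Fin (m + 2) => ind (A (T (σ k.succ)))) := by
          funext k
          refine Fin.cases ?_ (fun k' => ?_) k
          · simp only [Matrix.cons_val_zero, hσ0]
          · simp only [Matrix.cons_val_succ]
        rw [← sahiE_comp_perm (bernoulliWeight p) (m + 3) σ (fun k => ind (A (T k))), hfam]
        refine sahiE_cons_nonneg_of_absorbed ?_ ?_ ?_ ?_
        · rw [ex_bernoulliWeight_ind]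
          exact measureReal_le_one
        · have hj0 : σ.symm j ≠ 0 := by
            intro h0
            apply hij
            rw [← hσ0, ← h0, Equiv.apply_symm_apply]
          obtain ⟨k₀, hk₀⟩ := Fin.exists_succ_eq.2 hj0
          refine ⟨k₀, ?_⟩
          have hσk : σ k₀.succ = j := by rw [hk₀, Equiv.apply_symm_apply]
          show ind (A (T (σ k₀.succ))) * ind (A (T i)) = ind (A (T (σ k₀.succ)))
          rw [hσk]
          exact habsorb hsub
        · exact ih (fun k => T (σ k.succ))
        · intro k
          have hupd : Function.update (fun k' : Fin (m + 2) => ind (A (T (σ k'.succ)))) k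
              (ind (A (T (σ k.succ))) * ind (A (T i))) =
              fun k' => ind (A (Function.update (fun k' : Fin (m + 2) => T (σ k'.succ)) k (T (σ k.succ) ∪ T i) k')) := by
            funext k'
            by_cases hk : k' = k
            · subst hk
              simp only [Function.update_self, ind_mul_ind, hA]
            · simp only [Function.update_of_ne hk]
          rw [hupd]
          exact ih _

/-- **Antichain reduction with Sperner's bound.**  When the index type `β` is finite, an antichain family of finite
subsets of `β` has at most `C(|β|, ⌊|β|/2⌋)` members (Sperner), so the hypothesis of `sahiE_ind_nonneg_of_antichains` is
needed only for `3 ≤ k ≤ C(|β|, ⌊|β|/2⌋)`: for a fixed finite graph, Sahi positivity of all principal cluster families at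
ALL orders is a finite set of polynomial inequalities in the edge weights. [this work; Sperner's theorem from Mathlib] -/
theorem sahiE_ind_nonneg_of_antichains_sperner [Fintype β] (p : ι → unitInterval) (A : Finset β → Set (Set ι))
    (hA : ∀ T T' : Finset β, A (T ∪ T') = A T ∩ A T') (hup : ∀ T, IsUpperSet (A T))
    (H : ∀ (k : ℕ) (T : Fin (k + 3) → Finset β), k + 3 ≤ (Fintype.card β).choose (Fintype.card β / 2) →
      (Pairwise fun i j => ¬ T i ⊆ T j) → 0 ≤ sahiE (bernoulliWeight p) (k + 3) (fun i => ind (A (T i)))) :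
    ∀ (n : ℕ) (T : Fin n → Finset β), 0 ≤ sahiE (bernoulliWeight p) n (fun i => ind (A (T i))) := by
  refine sahiE_ind_nonneg_of_antichains p A hA hup fun k T hanti => H k T ?_ hanti
  -- an antichain family is injective, and its image is a Sperner antichain
  have hinj : Function.Injective T := by
    intro i j hTij
    by_contra hne
    exact hanti hne (hTij ▸ Finset.Subset.refl _)
  have hac : IsAntichain (· ⊆ ·) (SetLike.coe (Finset.univ.image T)) := by
    intro X hX Y hY hXY hsub
    rw [Finset.coe_image] at hX hY
    obtain ⟨i, -, rfl⟩ := hX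
    obtain ⟨j, -, rfl⟩ := hY
    have hij : i ≠ j := fun h => hXY (by rw [h])
    exact hanti hij hsub
  have hcard : (Finset.univ.image T).card = k + 3 := by
    rw [Finset.card_image_of_injective _ hinj, Finset.card_univ, Fintype.card_fin]
  have := hac.sperner
  rw [hcard] at this
  exact this

end General

/-! ### Part 2.  Percolation: principal cluster events with targets among three vertices -/

section ThreeTargets

variable {V : Type*} [Fintype V]

omit [Fintype V] in
/-- `{s ↔ s}` is the sure event. [folklore] -/
private theorem openConn_self (s : V) : (openConn s s : Set (BondConfig V)) = Set.univ := by
  ext ω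
  simp only [openConn, Set.mem_setOf_eq, Set.mem_univ, iff_true]
  exact SimpleGraph.Reachable.refl _

omit [Fintype V] in
/-- The principal event with targets `v j`, `j ∈ S`, is `∩`-multiplicative in `S`. [folklore] -/
private theorem principal_union (s : V) (v : Fin 3 → V) (S S' : Finset (Fin 3)) :
    (⋂ j ∈ S ∪ S', (openConn s (v j) : Set (BondConfig V))) =
      (⋂ j ∈ S, (openConn s (v j) : Set (BondConfig V))) ∩ ⋂ j ∈ S', (openConn s (v j) : Set (BondConfig V)) :=
  Finset.set_biInter_inter S S' _

omit [Fintype V] in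
/-- Principal cluster events are increasing. [folklore] -/
private theorem isUpperSet_principal (s : V) (v : Fin 3 → V) (S : Finset (Fin 3)) :
    IsUpperSet (⋂ j ∈ S, (openConn s (v j) : Set (BondConfig V))) :=
  isUpperSet_iInter₂ fun j _ => isUpperSet_openConn s (v j)

/-- The antichains of size `3` in `2^{Fin 3}`: the three singletons or the three pairs, in some order (kernel check). [folklore] -/
private theorem antichain_three_structure :
    ∀ S : Fin 3 → Finset (Fin 3), (∀ i j, i ≠ j → ¬ S i ⊆ S j) →
      (∃ σ : Equiv.Perm (Fin 3), ∀ i, S i = {σ i}) ∨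
        (∃ σ : Equiv.Perm (Fin 3), ∀ i, S i = Finset.univ.erase (σ i)) := by
  set_option maxRecDepth 100000 in
  decide

/-- Among four subsets of `Fin 3` two are nested (kernel check). [folklore] -/
private theorem nested_of_four : ∀ S₀ S₁ S₂ S₃ : Finset (Fin 3),
    S₀ ⊆ S₁ ∨ S₀ ⊆ S₂ ∨ S₀ ⊆ S₃ ∨ S₁ ⊆ S₀ ∨ S₁ ⊆ S₂ ∨ S₁ ⊆ S₃ ∨
      S₂ ⊆ S₀ ∨ S₂ ⊆ S₁ ∨ S₂ ⊆ S₃ ∨ S₃ ⊆ S₀ ∨ S₃ ⊆ S₁ ∨ S₃ ⊆ S₂ := by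
  set_option maxRecDepth 100000 in
  decide

/-- Two distinct co-points of `Fin 3` cover it (kernel check). [folklore] -/
private theorem erase_union_erase : ∀ a b : Fin 3, a ≠ b →
    Finset.univ.erase a ∪ Finset.univ.erase b = Finset.univ := by
  decide

/-- **Elementary cubic of the Δ-system** (plumbing for the three-pairs antichain): for reals with
`0 ≤ d ≤ x, y, z ≤ 1` (and `y, z ≥ 0`), `2d + xyz − d(x + y + z) = (x − d)yz + d((1 − y)(1 − z) + (1 − x)) ≥ 0`. [folklore] -/
private theorem deltaSystem_cubic_nonneg {d x y z : ℝ} (hd : 0 ≤ d) (hdx : d ≤ x) (hy : 0 ≤ y) (hz : 0 ≤ z)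
    (hx1 : x ≤ 1) (hy1 : y ≤ 1) (hz1 : z ≤ 1) :
    0 ≤ 2 * d + x * y * z - (x * d + y * d + z * d) := by
  have h1 : 0 ≤ (x - d) * y * z := mul_nonneg (mul_nonneg (sub_nonneg.2 hdx) hy) hz
  have h2 : 0 ≤ d * ((1 - y) * (1 - z)) := mul_nonneg hd (mul_nonneg (sub_nonneg.2 hy1) (sub_nonneg.2 hz1))
  have h3 : 0 ≤ d * (1 - x) := mul_nonneg hd (sub_nonneg.2 hx1)
  nlinarith [h1, h2, h3]

/-- **The increasing star at `(v₀, v₁, v₂)` implies Sahi positivity of EVERY order for EVERY family of principal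
cluster events `{C_s ⊇ T_i}` with `T_i ⊆ {v₀, v₁, v₂}`** (targets indexed by `S i : Finset (Fin 3)`; repeats, the empty
target set and coincidences among `s, v₀, v₁, v₂` allowed).  Proof: antichain reduction; the antichains of `2^{Fin 3}` of size
`≥ 3` are the three singletons (the star, hypothesis) and the three pairs (a Δ-system with core `{C_s ⊇ {v₀,v₁,v₂}}`, whose
`E₃` is nonnegative identically). [this work] -/
theorem sahiE_principal_threeTargets_of_incStar (w : Sym2 V → unitInterval) (s : V) (v : Fin 3 → V)
    (hstar : 0 ≤ sahiE3 (prodBernoulli w) (openConn s (v 0)) (openConn s (v 1)) (openConn s (v 2)))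
    (n : ℕ) (S : Fin n → Finset (Fin 3)) :
    0 ≤ sahiE (bernoulliWeight w) n (fun i => ind (⋂ j ∈ S i, (openConn s (v j) : Set (BondConfig V)))) := by
  refine sahiE_ind_nonneg_of_antichains w (fun S : Finset (Fin 3) => ⋂ j ∈ S, (openConn s (v j) : Set (BondConfig V)))
    (principal_union s v) (isUpperSet_principal s v) ?_ n S
  intro k T hanti
  -- no antichain of size ≥ 4
  cases k with
  | succ k =>
    exfalso
    let e : Fin 4 → Fin (k + 1 + 3) := Fin.castLE (by omega)
    have he : Function.Injective e := Fin.castLE_injective _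
    have ne : ∀ {i j : Fin 4}, i ≠ j → ¬ T (e i) ⊆ T (e j) := fun h => hanti (he.ne h)
    have h4 := nested_of_four (T (e 0)) (T (e 1)) (T (e 2)) (T (e 3))
    rcases h4 with h | h | h | h | h | h | h | h | h | h | h | h <;>
      first
      | exact ne (by decide) h
  | zero =>
    have hanti' : ∀ i j : Fin 3, i ≠ j → ¬ T i ⊆ T j := fun i j h => hanti h
    rcases antichain_three_structure T hanti' with ⟨σ, hσ⟩ | ⟨σ, hσ⟩
    · -- the three singletons: the increasing star itself, up to the order of the slots
      have hfam : (fun i => ind (⋂ j ∈ T i, (openConn s (v j) : Set (BondConfig V)))) =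
          fun i => (fun j : Fin 3 => ind (openConn s (v j) : Set (BondConfig V))) (σ i) := by
        funext i
        rw [hσ i, Finset.set_biInter_singleton]
      rw [hfam, sahiE_comp_perm (bernoulliWeight w) 3 σ (fun j : Fin 3 => ind (openConn s (v j) : Set (BondConfig V)))]
      have h3 : (fun j : Fin 3 => ind (openConn s (v j) : Set (BondConfig V))) =
          ![ind (openConn s (v 0) : Set (BondConfig V)), ind (openConn s (v 1) : Set (BondConfig V)),
            ind (openConn s (v 2) : Set (BondConfig V))] := by
        funext j; fin_cases j <;> rfl
      rw [h3, sahiE_three_ind]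
      exact hstar
    · -- the three pairs: a Δ-system with core D = {C_s ⊇ {v 0, v 1, v 2}}
      set D : Set (BondConfig V) := ⋂ j ∈ (Finset.univ : Finset (Fin 3)), (openConn s (v j) : Set (BondConfig V))
        with hD
      set F : Fin 3 → BondConfig V → ℝ := fun i => ind (⋂ j ∈ T i, (openConn s (v j) : Set (BondConfig V))) with hF
      have hpair : ∀ {i i' : Fin 3}, i ≠ i' → F i * F i' = ind D := by
        intro i i' hii'
        simp only [hF]
        rw [ind_mul_ind, ← principal_union, hσ i, hσ i',
          erase_union_erase (σ i) (σ i') (fun h => hii' (σ.injective h))]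
      have hsubD : ∀ i : Fin 3, D ⊆ ⋂ j ∈ T i, (openConn s (v j) : Set (BondConfig V)) := by
        intro i
        exact Set.biInter_subset_biInter_left fun j _ => Finset.mem_univ j
      have htriple : F 0 * F 1 * F 2 = ind D := by
        rw [hpair (show (0 : Fin 3) ≠ 1 by decide)]
        simp only [hF]
        rw [ind_mul_ind, Set.inter_eq_left.2 (hsubD 2)]
      -- the numbers
      have hx : ∀ i : Fin 3, 0 ≤ ex (bernoulliWeight w) (F i) := fun i => ex_nonneg
        (isFKGMeasure_bernoulliWeight w).nonneg fun ω => ind_nonneg _ _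
      have hx1 : ∀ i : Fin 3, ex (bernoulliWeight w) (F i) ≤ 1 := by
        intro i
        simp only [hF]
        rw [ex_bernoulliWeight_ind]
        exact measureReal_le_one
      have hd : 0 ≤ ex (bernoulliWeight w) (ind D) :=
        ex_nonneg (isFKGMeasure_bernoulliWeight w).nonneg fun ω => ind_nonneg _ _
      have hdx : ∀ i : Fin 3, ex (bernoulliWeight w) (ind D) ≤ ex (bernoulliWeight w) (F i) := fun i =>
        ex_mono (isFKGMeasure_bernoulliWeight w).nonneg fun ω => BHK2006.ind_mono (hsubD i) ω
      show 0 ≤ sahiE (bernoulliWeight w) 3 F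
      rw [sahiE_three_apply, htriple, hpair (show (1 : Fin 3) ≠ 2 by decide),
        hpair (show (0 : Fin 3) ≠ 2 by decide), hpair (show (0 : Fin 3) ≠ 1 by decide)]
      have key := deltaSystem_cubic_nonneg hd (hdx 0) (hx 1) (hx 2) (hx1 0) (hx1 1) (hx1 2)
      linarith [key]

/-- **Theorem 2 (iff).**  For a weighted graph, a root `s` and three vertices `v₀, v₁, v₂`: every family of principal
cluster events with targets among `v₀, v₁, v₂` is Sahi-positive at every order **iff** the increasing star
`E₃({s↔v₀},{s↔v₁},{s↔v₂}) ≥ 0` holds. [this work] -/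
theorem sahiE_principal_threeTargets_iff (w : Sym2 V → unitInterval) (s : V) (v : Fin 3 → V) :
    (∀ (n : ℕ) (S : Fin n → Finset (Fin 3)),
        0 ≤ sahiE (bernoulliWeight w) n (fun i => ind (⋂ j ∈ S i, (openConn s (v j) : Set (BondConfig V))))) ↔
      0 ≤ sahiE3 (prodBernoulli w) (openConn s (v 0)) (openConn s (v 1)) (openConn s (v 2)) := by
  constructor
  · intro h
    have h3 := h 3 (fun i => {i})
    have hfam : (fun i : Fin 3 => ind (⋂ j ∈ ({i} : Finset (Fin 3)), (openConn s (v j) : Set (BondConfig V)))) =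
        ![ind (openConn s (v 0) : Set (BondConfig V)), ind (openConn s (v 1) : Set (BondConfig V)),
          ind (openConn s (v 2) : Set (BondConfig V))] := by
      funext i; fin_cases i <;> simp only [Finset.set_biInter_singleton] <;> rfl
    rw [hfam, sahiE_three_ind] at h3
    exact h3
  · intro hstar
    exact sahiE_principal_threeTargets_of_incStar w s v hstar

end ThreeTargets

end SahiPrincipalAntichain

end Summit.CriticalPhenomena.PercolationContinuityZ3.Theorems

/-! ### Part 3 (gen 10, append).  Two generators: every order on every graph; four index points: orders `≤ 6` suffice -/

namespace Summit.CriticalPhenomena.PercolationContinuityZ3.Theorems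

namespace SahiPrincipalAntichain

open Finset MeasureTheory Literature.Combinatorics.Sahi2008 Literature.Probability.Percolation
  Literature.Probability.LatticeModels
open Literature.Probability.Percolation.DecisionTree (ind ind_of_mem ind_of_not_mem ind_nonneg)
open scoped Classical

section TwoGenerators

variable {ι : Type*} [Fintype ι]

/-- Three subsets of `Fin 2` always contain a nested pair (kernel check). [folklore] -/
private theorem nested_of_three_fin_two : ∀ S₀ S₁ S₂ : Finset (Fin 2),
    S₀ ⊆ S₁ ∨ S₀ ⊆ S₂ ∨ S₁ ⊆ S₀ ∨ S₁ ⊆ S₂ ∨ S₂ ⊆ S₀ ∨ S₂ ⊆ S₁ := by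
  decide

/-- **Two generators: Sahi positivity of EVERY order, unconditionally.**  An `∩`-closed family of increasing events indexed by the
subsets of a two-element set — i.e. the lattice `{A ∅ ⊇ A{0}, A{1} ⊇ A{0,1} = A{0} ∩ A{1}}` generated by TWO increasing events under a
product weight — has `E_n ≥ 0` for every `n` and every family drawn from it (repeats allowed): there is no antichain of size `≥ 3`, so the
antichain reduction needs Harris only.  (The event-level form of Sahi's two-point theorem [Sahi2008, Prop. 15], for arbitrary increasing
events of a product space.) [this work] -/
theorem sahiE_ind_nonneg_of_twoGenerators (p : ι → unitInterval) (A : Finset (Fin 2) → Set (Set ι))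
    (hA : ∀ T T' : Finset (Fin 2), A (T ∪ T') = A T ∩ A T') (hup : ∀ T, IsUpperSet (A T))
    (n : ℕ) (T : Fin n → Finset (Fin 2)) : 0 ≤ sahiE (bernoulliWeight p) n (fun i => ind (A (T i))) := by
  refine sahiE_ind_nonneg_of_antichains p A hA hup (fun k T hanti => ?_) n T
  exfalso
  let e : Fin 3 → Fin (k + 3) := Fin.castLE (by omega)
  have he : Function.Injective e := Fin.castLE_injective _
  have ne : ∀ {i j : Fin 3}, i ≠ j → ¬ T (e i) ⊆ T (e j) := fun h => hanti (he.ne h)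
  rcases nested_of_three_fin_two (T (e 0)) (T (e 1)) (T (e 2)) with h | h | h | h | h | h <;>
    first
    | exact ne (by decide) h

variable {V : Type*} [Fintype V]

omit [Fintype V] in
/-- `⋂` over a union of index sets (plumbing). [folklore] -/
private theorem principal_union₂ (s : V) (U : Fin 2 → Finset V) (S S' : Finset (Fin 2)) :
    (⋂ j ∈ S ∪ S', ⋂ t ∈ U j, (openConn s t : Set (BondConfig V))) =
      (⋂ j ∈ S, ⋂ t ∈ U j, (openConn s t : Set (BondConfig V))) ∩
        ⋂ j ∈ S', ⋂ t ∈ U j, (openConn s t : Set (BondConfig V)) :=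
  Finset.set_biInter_inter S S' _

/-- **Two target sets, every graph, every order.**  For any weighted graph, root `s` and target sets `U₀, U₁`: every family drawn from the
principal cluster events `{C_s ⊇ U₀}`, `{C_s ⊇ U₁}`, `{C_s ⊇ U₀ ∪ U₁}` (and the sure event), with repeats, has `E_n ≥ 0` — on EVERY finite
graph, with no hypothesis (indexing: slot `i` is `⋂_{j ∈ S i} {C_s ⊇ U_j}`, `S i ⊆ Fin 2`). [this work] -/
theorem sahiE_principal_twoTargetSets (w : Sym2 V → unitInterval) (s : V) (U : Fin 2 → Finset V)
    (n : ℕ) (S : Fin n → Finset (Fin 2)) :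
    0 ≤ sahiE (bernoulliWeight w) n
      (fun i => ind (⋂ j ∈ S i, ⋂ t ∈ U j, (openConn s t : Set (BondConfig V)))) :=
  sahiE_ind_nonneg_of_twoGenerators w (fun S : Finset (Fin 2) => ⋂ j ∈ S, ⋂ t ∈ U j, (openConn s t : Set (BondConfig V)))
    (principal_union₂ s U) (fun _ => isUpperSet_iInter₂ fun _ _ => isUpperSet_iInter₂ fun t _ => isUpperSet_openConn s t) n S

end TwoGenerators

section FourIndex

variable {ι : Type*} [Fintype ι]

/-- **Four index points: orders `3 ≤ k ≤ 6` suffice.**  For an `∩`-closed family of increasing events indexed by the subsets of a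
four-element set (e.g. the principal cluster events with targets among four vertices — every principal family of a five-vertex graph):
if the antichain families of sizes `3, 4, 5, 6` have `E_k ≥ 0`, then every family of every order has `E_n ≥ 0` (Sperner: `C(4,2) = 6`).
These are the finitely many inequalities that the exact `k`-copy fibre certificates of the memo (`K₅`, 17 antichain orbits) establish. [this work] -/
theorem sahiE_ind_nonneg_fourIndex_of_le_six (p : ι → unitInterval) (A : Finset (Fin 4) → Set (Set ι))
    (hA : ∀ T T' : Finset (Fin 4), A (T ∪ T') = A T ∩ A T') (hup : ∀ T, IsUpperSet (A T))
    (H : ∀ (k : ℕ) (T : Fin (k + 3) → Finset (Fin 4)), k + 3 ≤ 6 →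
      (Pairwise fun i j => ¬ T i ⊆ T j) → 0 ≤ sahiE (bernoulliWeight p) (k + 3) (fun i => ind (A (T i)))) :
    ∀ (n : ℕ) (T : Fin n → Finset (Fin 4)), 0 ≤ sahiE (bernoulliWeight p) n (fun i => ind (A (T i))) := by
  refine sahiE_ind_nonneg_of_antichains_sperner p A hA hup fun k T hk hanti => H k T ?_ hanti
  have h6 : (Fintype.card (Fin 4)).choose (Fintype.card (Fin 4) / 2) = 6 := by decide
  rw [h6] at hk
  exact hk

end FourIndex

end SahiPrincipalAntichain

end Summit.CriticalPhenomena.PercolationContinuityZ3.Theorems
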